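import Summits.HodgeConjecture.HodgeConjecture.Theorems.NikulinTwinTransportHodgeSimilitudeAlgebraicFrontier
import Summits.HodgeConjecture.HodgeConjecture.Theorems.NikulinTwinTransportHodgeIsometryAlgebraicCup
import Summits.HodgeConjecture.HodgeConjecture.Theorems.NikulinTwinTransportTwinAnchorGlue
import Literature.AlgebraicGeometry.HodgeTheory.GysinBaseChange

/-!
# Route NikulinTwinTransport · target X (stmt-HodgeConjecture-13674) and crux `HodgeSimilitudeAlgebraic`
# (stmt-HodgeConjecture-13676) on the frontier WITHOUT the Künneth hypothesis

Sequel of this seat's `…HodgeSimilitudeAlgebraicFrontier` (X and the crux on the primitive frontier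
{`Huybrechts_K3_periodSurjective_projective`, `Huybrechts_K3_marking_exists`,
`Huybrechts_K3_hodgeTypes_H2`, Buskin's Prop. 6.2 at one orientation family `ReflAt[μ₀]`,
`KunnethSpan`, `CupAlg`, twin transport}). The Künneth spanning property is now a THEOREM of the
tree — `Literature.AlgebraicGeometry.HodgeTheory.kunnethSpan_complexBetti` (`HodgeTheory/GysinBaseChange`,
from `SingularHomology/KunnethFormula`) and, in graded-basis / bijective form, this seat's
`SingularHomology/ProductKunneth(Field)` + `HodgeTheory/ComplexBettiKunneth` — so `KunnethSpan`
is substituted away: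

* `twinSimilitudeAlgebraic_of_twinTwistorTransport_frontier` — **the target X from the typed
  transport crux `TwinTwistorTransport`** (stmt-HodgeConjecture-14393), the two K3 period facts,
  Prop. 6.2 at `μ₀` and `CupAlg` (the landed `twinAnchorGlue_of_cup` with Buskin's item discharged
  by seat 0's `hodgeIsometryAlgebraic_of_reflective_of_cup`);
* `twinSimilitudeAlgebraic_of_twinTransport_of_cupAlg` — X from Buskin's item, the three K3 facts,
  `CupAlg` and ONE lattice twin transport;
* `hodgeSimilitudeAlgebraic_iff_prime_twinTransport_of_cupAlg` — the crux is EQUIVALENT to twin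
  transport at every prime modulo Buskin's item, `CupAlg` and the three K3 facts;
* `hodgeSimilitudeAlgebraic_of_prime_twinTransport_frontier'` — **the crux on the frontier
  {three K3 facts, Prop. 6.2 at `μ₀`, `CupAlg`, twin transport per prime}**.

What remains inline: `CupAlg` (`N² ∪ N² ⊆ N⁴` on triple products of surfaces — Chow moving on
the coniveau carrier) and the research content (twin transports / `TwinTwistorTransport`,
Prop. 6.2), plus the three K3 named facts. No `sorry`; standard axioms; one-line compositions.
-/

noncomputable section

open CategoryTheory MonoidalCategory
open scoped Manifold
open Literature.AlgebraicGeometry.Motives Literature.AlgebraicGeometry.HodgeTheory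
open Literature.AlgebraicGeometry.Surfaces Literature.Geometry.Kaehler
open Literature.AlgebraicTopology.SingularHomology
open Summit.HodgeConjecture.HodgeConjecture.Theses.NikulinTwinTransport

namespace Summit.HodgeConjecture.HodgeConjecture.Theorems.NikulinTwinTransport

/-! ### Local notations (verbatim those of the files assembled here) -/

/-- `MarkedK3[S, η, p, x]`: a marked K3 surface with period `x`. Local notation only. -/
local notation3 (prettyPrint := false) "MarkedK3[" S ", " η ", " p ", " x "]" =>
  (IsIntegralClass p ∧
    (∀ q : complexBetti S (2 * 2), IsIntegralClass q → ∃ n : ℤ, q = n • p) ∧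
    (∀ c : complexBetti S (2 * 1), IsIntegralClass c ↔ ∃ v : K3Index → ℤ, η c = fun i => (v i : ℂ)) ∧
    (∀ a b : complexBetti S (2 * 1),
        cupProduct (rfl : 2 * 1 + 2 * 1 = 2 * 2) a b = k3Form (η a) (η b) • p) ∧
    IsOfHodgeType 2 S (2 * 1) 2 0 (LinearEquiv.symm η x) ∧
    (∀ τ : complexBetti S (2 * 1), IsOfHodgeType 2 S (2 * 1) 2 0 τ → ∃ t : ℂ, τ = t • LinearEquiv.symm η x))

/-- `PeriodPt[x]`: a projective period point. Local notation only. -/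
local notation3 (prettyPrint := false) "PeriodPt[" x "]" =>
  (k3Form x x = 0 ∧ 0 < (k3Form (star x) x).re ∧
    ∃ u : K3Index → ℤ, k3Form (fun i => (u i : ℂ)) x = 0 ∧ 0 < ∑ i, ∑ j, u i * k3Gram i j * u j)

/-- `Corr[μ, S, S', hS, hS' ; γ, y] = [γ]_* y`. Local notation only. -/
local notation3 (prettyPrint := false) "Corr[" μ ", " S ", " S' ", " hS ", " hS' " ; " γ ", " y "]" =>
  complexGysin μ
    (IsSmoothProjective.tensor_holds (IsK3Surface.isSmoothProjective hS)
      (IsK3Surface.isSmoothProjective hS'))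
    (IsK3Surface.isSmoothProjective hS) (SemiCartesianMonoidalCategory.fst S S')
    (rfl : 2 * 1 + 2 * 2 + 2 * 2 = 2 * 1 + 2 * (2 + 2))
    (cupProduct (rfl : 2 * 1 + 2 * 2 = 2 * 1 + 2 * 2)
      (complexBetti.map (SemiCartesianMonoidalCategory.snd S S') (2 * 1) y) γ)

/-- `TwinTransportFor[M]`: the twin transport for the endomorphism `M` of `Λ_ℂ`. Local notation only. -/
local notation3 (prettyPrint := false) "TwinTransportFor[" M "]" =>
  ∀ (μ : OrientationFamily), μ.HasPoincareDuality →
    ∀ (S S' : SchemeOver ℂ) (hS : IsK3Surface S) (hS' : IsK3Surface S')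
      (η : complexBetti S (2 * 1) ≃ₗ[ℂ] (K3Index → ℂ)) (p : complexBetti S (2 * 2))
      (x : K3Index → ℂ)
      (η' : complexBetti S' (2 * 1) ≃ₗ[ℂ] (K3Index → ℂ)) (p' : complexBetti S' (2 * 2))
      (x' : K3Index → ℂ),
      MarkedK3[S, η, p, x] → PeriodPt[x] → MarkedK3[S', η', p', x'] → PeriodPt[x'] →
      (∃ t : ℂ, M x' = t • x) →
      ∃ γ ∈ algebraicClasses (MonoidalCategoryStruct.tensorObj S S') 2,
        ∀ y : complexBetti S' (2 * 1), η.symm (M (η' y)) = Corr[μ, S, S', hS, hS' ; γ, y]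

/-- `RatTwinTransportAt[c]`: twin transport for every rational `c`-similitude of `Λ_ℂ` with rational
two-sided inverse. Local notation only. -/
local notation3 (prettyPrint := false) "RatTwinTransportAt[" c "]" =>
  ∀ (M N : Module.End ℂ (K3Index → ℂ)),
    (∀ v : K3Index → ℤ, ∃ w : K3Index → ℚ, M (fun i => (v i : ℂ)) = fun i => (w i : ℂ)) →
    (∀ v : K3Index → ℤ, ∃ w : K3Index → ℚ, N (fun i => (v i : ℂ)) = fun i => (w i : ℂ)) →
    M * N = 1 → N * M = 1 → (∀ a b, k3Form (M a) (M b) = c * k3Form a b) → TwinTransportFor[M]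

/-- `ReflAt[μ₀]`: Buskin's Prop. 6.2 — REFLECTIVE rational Hodge isometries `η⁻¹ ∘ s_v ∘ η'` between
marked projective K3 surfaces are algebraic — at the orientation family `μ₀`; symbol for symbol the
hypothesis `hrefl` of `hodgeIsometryAlgebraic_of_reflective`. Local notation only. -/
local notation3 (prettyPrint := false) "ReflAt[" μ₀ "]" =>
  ∀ (S S' : SchemeOver ℂ) (hS : IsK3Surface S) (hS' : IsK3Surface S')
    (η : complexBetti S (2 * 1) ≃ₗ[ℂ] (K3Index → ℂ)) (p : complexBetti S (2 * 2)) (x : K3Index → ℂ)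
    (η' : complexBetti S' (2 * 1) ≃ₗ[ℂ] (K3Index → ℂ)) (p' : complexBetti S' (2 * 2))
    (x' : K3Index → ℂ),
    MarkedK3[S, η, p, x] → PeriodPt[x] → MarkedK3[S', η', p', x'] → PeriodPt[x'] →
    ∀ v : K3Index → ℤ, ∑ i, ∑ j, v i * k3Gram i j * v j ≠ 0 →
    (∃ t : ℂ, k3ReflectionC v x' = t • x) →
    ∃ γ ∈ algebraicClasses (MonoidalCategoryStruct.tensorObj S S') 2, ∀ y : complexBetti S' (2 * 1),
      η.symm (k3ReflectionC v (η' y)) = Corr[μ₀, S, S', hS, hS' ; γ, y]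

/-- `CupAlg`: `N² H⁴ ∪ N² H⁴ ⊆ N⁴ H⁸` on triple products of surfaces, verbatim from
`NikulinTwinTransportHodgeSimilitudeAlgebraicBaseChange`. Local notation only. -/
local notation3 (prettyPrint := false) "CupAlg" =>
  ∀ (A B C : SchemeOver ℂ), IsSmoothProjective 2 A → IsSmoothProjective 2 B →
    IsSmoothProjective 2 C →
    ∀ a ∈ algebraicClasses (MonoidalCategoryStruct.tensorObj A (MonoidalCategoryStruct.tensorObj B C)) 2,
      ∀ b ∈ algebraicClasses (MonoidalCategoryStruct.tensorObj A (MonoidalCategoryStruct.tensorObj B C)) 2,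
        cupProduct ((Nat.mul_add 2 2 2).symm : 2 * 2 + 2 * 2 = 2 * (2 + 2)) a b ∈
          algebraicClasses (MonoidalCategoryStruct.tensorObj A (MonoidalCategoryStruct.tensorObj B C)) (2 + 2)

/-- `KunnethSpan`: **the spanning half of the Künneth formula** for the complex points of smooth
projective varieties — every class on `(Y ⊗ Z)(ℂ)` is a `ℂ`-combination of cross products
`fst^* b ∪ snd^* w` (Hatcher Thm. 3.15 with Cor. A.12); symbol for symbol the hypothesis `hK` of seat 0's
`gysin_baseChange_of_kunneth`. Local notation only. -/
local notation3 (prettyPrint := false) "KunnethSpan" =>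
  ∀ ⦃m' n' : ℕ⦄ ⦃Y' Z' : SchemeOver ℂ⦄, IsSmoothProjective m' Y' → IsSmoothProjective n' Z' →
    ∀ (k : ℕ) (z : complexBetti (MonoidalCategoryStruct.tensorObj Y' Z') k), z ∈ Submodule.span ℂ
      {v | ∃ (i j : ℕ) (h : i + j = k) (b : complexBetti Y' i) (w : complexBetti Z' j),
        v = cupProduct h (complexBetti.map (SemiCartesianMonoidalCategory.fst Y' Z') i b)
          (complexBetti.map (SemiCartesianMonoidalCategory.snd Y' Z') j w)}

/-! ### The target X -/

/-- **The target X from the typed transport crux**: `TwinTwistorTransport` (stmt-HodgeConjecture-14393),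
the two K3 period facts, Buskin's Prop. 6.2 at `μ₀` and `CupAlg` give `TwinSimilitudeAlgebraic`
(the landed `twinAnchorGlue_of_cup` with Buskin's item discharged by seat 0's
`hodgeIsometryAlgebraic_of_reflective_of_cup`). [cite: Buskin2019, Thm. 1.1, Prop. 6.2] [cite: Varesco2023, §2] -/
theorem twinSimilitudeAlgebraic_of_twinTwistorTransport_frontier (μ₀ : OrientationFamily)
    (hP : Huybrechts_K3_periodSurjective_projective) (hmark : Huybrechts_K3_marking_exists)
    (hrefl : ReflAt[μ₀]) (hCUP : CupAlg) (hT : Theses.NikulinTwinTransport.TwinTwistorTransport) :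
    Theses.NikulinTwinTransport.TwinSimilitudeAlgebraic :=
  twinAnchorGlue_of_cup hCUP (hodgeIsometryAlgebraic_of_reflective_of_cup μ₀ hP hmark hrefl hCUP) hT

/-- **X from one lattice twin transport**, `KunnethSpan` discharged: Buskin's item, the three K3
facts, `CupAlg` and ONE twin transport for a rational `2`-similitude `M` of `Λ_ℂ` with rational
inverse give `TwinSimilitudeAlgebraic`. [cite: Buskin2019, Thm. 1.1 and Lemma 6.3] -/
theorem twinSimilitudeAlgebraic_of_twinTransport_of_cupAlg
    (hB : Theses.NikulinTwinTransport.HodgeIsometryAlgebraic)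
    (hP : Huybrechts_K3_periodSurjective_projective) (hM : Huybrechts_K3_marking_exists)
    (hHT : Huybrechts_K3_hodgeTypes_H2) (hCUP : CupAlg)
    (M N : Module.End ℂ (K3Index → ℂ))
    (hNrat : ∀ v : K3Index → ℤ, ∃ w : K3Index → ℚ, N (fun i => (v i : ℂ)) = fun i => (w i : ℂ))
    (hMN : M * N = 1) (hM2 : ∀ a b, k3Form (M a) (M b) = 2 * k3Form a b)
    (htw : TwinTransportFor[M]) :
    Theses.NikulinTwinTransport.TwinSimilitudeAlgebraic :=
  twinSimilitudeAlgebraic_of_twinTransport_of_kunneth hB hP hM hHT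
    (fun _ _ _ _ hY hZ k z ↦ kunnethSpan_complexBetti hY hZ k z) hCUP M N hNrat hMN hM2 htw

/-! ### The crux on the frontier {K3 facts, Prop. 6.2, `CupAlg`, twin transport per prime} -/

/-- **The crux is equivalent to twin transport at every prime, modulo Buskin's item, `CupAlg` and the
three K3 facts** (`KunnethSpan` discharged). [cite: Buskin2019, Thm. 1.1 and Lemma 6.3] [cite: Fulton1998, Prop. 16.1.1] -/
theorem hodgeSimilitudeAlgebraic_iff_prime_twinTransport_of_cupAlg
    (hB : Theses.NikulinTwinTransport.HodgeIsometryAlgebraic) (hCUP : CupAlg)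
    (hP : Huybrechts_K3_periodSurjective_projective) (hMk : Huybrechts_K3_marking_exists)
    (hHT : Huybrechts_K3_hodgeTypes_H2) :
    Theses.NikulinTwinTransport.HodgeSimilitudeAlgebraic ↔
      ∀ q : ℕ, q.Prime → RatTwinTransportAt[((q : ℕ) : ℂ)] :=
  hodgeSimilitudeAlgebraic_iff_prime_twinTransport_of_kunneth hB
    (fun _ _ _ _ hY hZ k z ↦ kunnethSpan_complexBetti hY hZ k z) hCUP hP hMk hHT

/-- **THE CRUX ON THE FRONTIER, Künneth discharged.** Granted the named facts
`Huybrechts_K3_periodSurjective_projective`, `Huybrechts_K3_marking_exists`,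
`Huybrechts_K3_hodgeTypes_H2`, Buskin's Prop. 6.2 at ONE orientation family `μ₀` and the
multiplicativity `CupAlg`: twin transport for the rational `q`-similitudes of the K3 lattice at every
prime `q` gives `HodgeSimilitudeAlgebraic`. [cite: Buskin2019, Thm. 1.1, Prop. 6.2, Lemma 6.3]
[cite: Varesco2023, Thm. 2.1] -/
theorem hodgeSimilitudeAlgebraic_of_prime_twinTransport_frontier' (μ₀ : OrientationFamily)
    (hP : Huybrechts_K3_periodSurjective_projective) (hMk : Huybrechts_K3_marking_exists)
    (hHT : Huybrechts_K3_hodgeTypes_H2) (hrefl : ReflAt[μ₀]) (hCUP : CupAlg)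
    (htw : ∀ q : ℕ, q.Prime → RatTwinTransportAt[((q : ℕ) : ℂ)]) :
    Theses.NikulinTwinTransport.HodgeSimilitudeAlgebraic :=
  hodgeSimilitudeAlgebraic_of_prime_twinTransport_of_kunneth
    (hodgeIsometryAlgebraic_of_reflective_of_cup μ₀ hP hMk hrefl hCUP)
    (fun _ _ _ _ hY hZ k z ↦ kunnethSpan_complexBetti hY hZ k z) hCUP hP hMk hHT htw

end Summit.HodgeConjecture.HodgeConjecture.Theorems.NikulinTwinTransport

end
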